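import Summits.QuantumFields.Balaban3D.Proofs.Inputs
import Summits.QuantumFields.Balaban3D.Proofs.Run3RepresentationStd

/-!
# Bałaban CMP 102 (1985), d = 3 lane — `Proofs.AlphaRepr`: the REPRESENTATION residuals of `Proofs.Residuals` (rows C5 `repr33_60`,
# C6 `vacuumWhole`, C7 `decomp35_61`, C8 `norm35`, B20 `logZT_le`) AT THE LANE'S PIECES `Inputs.pieces 𝔎 X 𝔖 k`, REDUCED to seat
# p6's (α) inputs by APPLICATION of `Proofs.Run3RepresentationStd` (carriers frozen at p1 v1.3b) — every run slot that is arithmetic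
# of the lane's objects (`k ≤ K`, `0 < κ₀`, `0 < p₀`, `0 ≤ b₀`, `r₀ ≥ 1`, `R₁ ≥ 6 + 2κ₀` from the record; the remainder unit, the
# retained radius `Rret = R₁r(g_k)` and the block count `#(blocks ∖ Ω_{k+1}(h)) ≤ |Z_k(h)|` definitional / p1's theorem; the cube count
# `Nblk³ ≤ |T₁^{(k)}|` = `Inputs.nblk_cube_le_sites`) DISCHARGED here, and «(63) as cited» taken as the TREE binder G3D-07
# `Binders.LogZLocalizedAsCited` (p6 `LogZLocalization.ofCited`)

Source: T. Bałaban, *Ultraviolet stability of three-dimensional lattice pure gauge field theories*, Commun. Math. Phys. **102** (1985)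
255–275 [Balaban1985UV3] ([B10]; PDF page = journal page − 254): (26)–(33) pp. 263–264, (35) p. 265, (60)–(63) pp. 271–272, (65)
p. 273.  Lane `pub-balaban3d`, seat p3 (assembly; PLAN §0.5 E4, rulings R-DISP / R-ACT / R-32 / R-32′ / R-FL / R-OMEGA; LEAF-LEDGER
C5–C8, B20); the leaves are seat p6's (`Run3RepresentationStd.repr33_60_std`, `vacuumWhole_std`, `decomp35_61_std`,
`Run3Representation.norm35_series`, `logZT_le_series`).

WHAT REMAINS AS HYPOTHESES after this file (the (α) END INPUTS of rows C5–C8/B20, by class; LEAF-LEDGER §F):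
* GAP binders by name: G3D-01 `Binders.ChartAnalyticityAsCited` for the charts `Ψ_X` of the expansion data at the (25)-rate
  `C25·g_k·e^{−κ𝓛(X)}` (R-ACT), G3D-06 `Binders.FarTermsDecayAsCited`, G3D-04 `Binders.Norm35StepAsCited`, G3D-05
  `Binders.LogZTExtensiveAsCited`, G3D-07 `Binders.LogZLocalizedAsCited` («(63) as cited», for the DEFINED `logZU`/`logZ1`);
* (α) data displays: (28) `bound28` with its smallness `small28` (⇐ `g_k ≤ γ₂₈`, discharged where `γ₀` is fixed), (26) in the chart
  space `inv26` for a linear action `π` with the detecting property `hdet` (⇒ (32), R-32; at the pinned chart space `𝔤ᶜ` of R-32′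
  `hdet` is seat p4's THEOREM `GroupModelLieC.hdet_lieC_pi`), the identifications `hPY`/`hPYZ` of the data `PY`/`PYZ` with the
  retained jets (batch 11 (a));
* constants: the record's `C₂, Cv, C₃, C₄, C₅, z` EQUAL p6's closed expressions (`hC₂`, …; `rfl` at `Primitives.lane`) and the windows
  `κ ≥ κ₀(32,6)+1`, `C25·K₀ ≤ CM`, `C63·K₀ ≤ CM`, `κ₀ < ½`, `0 < c`, `κc.r₀ = r₀`.
HONEST FRAMING (PLAN §0): application bookkeeping; the inputs above are hypotheses; nothing of the paper is asserted.  No `sorry`.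
-/

noncomputable section

namespace Summit.QuantumFields.Balaban3D.Proofs.AlphaRepr

open scoped Topology
open Metric
open Literature.MathematicalPhysics.QuantumFieldTheory.Balaban1983to89
open Literature.MathematicalPhysics.QuantumFieldTheory.Balaban1983to89.B10
open Literature.MathematicalPhysics.QuantumFieldTheory.Balaban1983to89.B10SectAGathering
open Literature.MathematicalPhysics.QuantumFieldTheory.Balaban1983to89.B10Assembly
open Literature.MathematicalPhysics.QuantumFieldTheory.Balaban1983to89.B12TreeDecay (kappa₀ K₀)
open Literature.MathematicalPhysics.QuantumFieldTheory.Balaban1983to89.TreeLengthTorus (tsys tcubeSys TPt)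
open Literature.MathematicalPhysics.QuantumFieldTheory.Balaban1985CMP102
open Literature.MathematicalPhysics.QuantumFieldTheory.Balaban1985CMP102.Setting
open Literature.MathematicalPhysics.QuantumFieldTheory.Balaban1985CMP102.Binders
  (ChartAnalyticityAsCited FarTermsDecayAsCited Norm35StepAsCited LogZTExtensiveAsCited LogZLocalizedAsCited)
open Summit.QuantumFields.Balaban3D.Carriers
open Summit.QuantumFields.Balaban3D.Proofs.ScalesArithmetic
open Summit.QuantumFields.Balaban3D.Proofs.Constants
open Summit.QuantumFields.Balaban3D.Proofs.Representation33
open Summit.QuantumFields.Balaban3D.Proofs.LogZLocalized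
open Summit.QuantumFields.Balaban3D.Proofs.Run3Representation
open Summit.QuantumFields.Balaban3D.Proofs.Run3RepresentationStd
open Summit.QuantumFields.Balaban3D.Proofs.Inputs

variable {L : ℕ} (𝔎 : LaneConsts L) {S : Scales L} {G : Type} [GaugeGroup G] [MeasurableSpace G] [HaarData G]
  {V : Type} [NormedAddCommGroup V] [NormedSpace ℂ V]
  (X : ExternalInputs S G) (𝔖 : ∀ k, StepSeries S G V (nblkOf S 𝔎.carrier k) k) (k : ℕ)

/-! ## C5 — `repr33_60` -/

/-- **Row C5 AT THE LANE'S PIECES** — (33) p. 264 / (60) p. 271 for `Inputs.pieces 𝔎 X 𝔖 k` with the record's `C₂`, from p6's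
`repr33_60_std`: (α) inputs G3D-01 `chart`, (28) `bound28`/`small28`, (26)+detecting `inv26`/`hdet` (⇒ (32)), G3D-06 `far_le`, the
identification `hPY`; constants `hC₂`, `κ ≥ κ₀(32,6)`, `0 ≤ C25`, `C25·K₀ ≤ CM`, `κ₀ < ½`; the slots `k ≤ K`, `0 < p₀`, `0 ≤ b₀`,
`Nblk³ ≤ |T₁^{(k)}|` DISCHARGED. [cite: Balaban1985UV3, (33) p.264 + (60) p.271] -/
theorem repr33_60_pieces [FiniteDimensional ℂ V] (hk : k + 1 ≤ S.K) (κc : ChartConsts) {κ C25 : ℝ}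
    (hκ : kappa₀ (4 * 2 ^ 3) (2 * 3) ≤ κ) (hC25 : 0 ≤ C25) (hCM : C25 * K₀ (4 * 2 ^ 3) (2 * 3) ≤ κc.CM)
    (hκ₀ : 𝔎.F.κ₀ < 1 / 2) (hC₂ : 𝔎.sc.C₂ = rawConst7 κc.Craw 𝔎.F.b₀ κc.r₀ 𝔎.F.p₀ 1 𝔎.F.κ₀)
    (chart : ∀ Y, ChartAnalyticityAsCited ((𝔖 k).Ψ Y) κc.ρ
      (C25 * S.gk k * Real.exp (-(κ * (tsys 3 (nblkOf S 𝔎.carrier k)).dj Y))))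
    (bound28 : ∀ Y h U, ‖(𝔖 k).Bcfg Y h U‖ ≤ κc.cB * (rFun κc.r₀ (S.gk k) * S.gk k * pFun 𝔎.F.b₀ 𝔎.F.p₀ (S.gk k)))
    (small28 : κc.cB * (rFun κc.r₀ (S.gk k) * S.gk k * pFun 𝔎.F.b₀ 𝔎.F.p₀ (S.gk k)) ≤ κc.ρ / 4)
    {Γ : Type*} (π : Γ → (𝔖 k).E →L[ℂ] (𝔖 k).E)
    (inv26 : ∀ Y u, ∀ b ∈ ball (0 : (𝔖 k).E) κc.ρ, π u b ∈ ball (0 : (𝔖 k).E) κc.ρ → (𝔖 k).Ψ Y (π u b) = (𝔖 k).Ψ Y b)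
    (hdet : ∀ φ : (𝔖 k).E →L[ℂ] ℂ, (∀ u, φ.comp (π u) = φ) → φ = 0)
    (far_le : FarTermsDecayAsCited (𝔖 k).far (fun Y => C25 * S.gk k * Real.exp (-(κ * (tsys 3 (nblkOf S 𝔎.carrier k)).dj Y)))
      κc.Cfar (S.gk k ^ 7 * (rFun κc.r₀ (S.gk k) * pFun 𝔎.F.b₀ 𝔎.F.p₀ (S.gk k)) ^ 7))
    (hPY : ∀ h U, (𝔖 k).PY h U
      = ∑ Y ∈ (𝔖 k).loc (ΩblkOf 𝔎.carrier.M₁ (rcolOf S 𝔎.carrier) (nblkOf S 𝔎.carrier k)) (rretOf S 𝔎.carrier k) h,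
          ((jet26 ((𝔖 k).Ψ Y) ((𝔖 k).Bcfg Y h U)).re - (𝔖 k).far Y h U)) :
    Repr33_60 (pieces 𝔎 X 𝔖 k) 𝔎.sc.C₂ := by
  rw [hC₂]
  exact repr33_60_std X 𝔎.carrier 𝔖 k (by omega) κc hκ hC25 hCM hκ₀ 𝔎.F.p₀_pos 𝔎.F.b₀_nonneg
    (nblk_cube_le_sites 𝔎 k (by omega)) chart bound28 small28 π inv26 hdet far_le hPY

/-! ## C6 — `vacuumWhole` -/

/-- **Row C6 AT THE LANE'S PIECES** — the whole-lattice vacuum sum (p. 265 L2–4 / p. 270 L30–33) for `Inputs.pieces 𝔎 X 𝔖 k` with the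
record's `Cv`, `C₃`, from p6's `vacuumWhole_std`: (α) input G3D-01 `chart`; constants `hCv`, `hC₃`, `κ ≥ κ₀(32,6)+1`, `0 ≤ C25`; the slots
`k ≤ K`, `0 < κ₀`, `r₀ ≥ 1`, `R₁ ≥ 6 + 2κ₀`, `Nblk³ ≤ |T₁^{(k)}|`, the retained radius (`rfl`) and the block count (p1's theorem) DISCHARGED.
[cite: Balaban1985UV3, p.265 + p.270 + (25) p.262] -/
theorem vacuumWhole_pieces (hk : k + 1 ≤ S.K) {ρ κ C25 : ℝ} (hκ : kappa₀ (4 * 2 ^ 3) (2 * 3) + 1 ≤ κ) (hC25 : 0 ≤ C25)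
    (hr₀ : 1 ≤ 𝔎.F.r₀) (hR₁ : 6 + 2 * 𝔎.F.κ₀ ≤ 𝔎.F.R₁)
    (hCv : 𝔎.sc.Cv = C25 * K₀ (4 * 2 ^ 3) (2 * 3))
    (hC₃ : 𝔎.sc.C₃ = rawConstR (C25 * K₀ (4 * 2 ^ 3) (2 * 3)) 𝔎.F.R₁ 1 𝔎.F.κ₀)
    (chart : ∀ Y, ChartAnalyticityAsCited ((𝔖 k).Ψ Y) ρ
      (C25 * S.gk k * Real.exp (-(κ * (tsys 3 (nblkOf S 𝔎.carrier k)).dj Y)))) :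
    VacuumWhole (pieces 𝔎 X 𝔖 k) 𝔎.sc.Cv 𝔎.sc.C₃ := by
  rw [hCv, hC₃]
  exact vacuumWhole_std X 𝔎.carrier 𝔖 k (by omega) hκ hC25 𝔎.F.κ₀_pos hr₀ hR₁ (nblk_cube_le_sites 𝔎 k (by omega)) chart

/-! ## C7 — `decomp35_61` from the TREE binder G3D-07 -/

/-- **Row C7 AT THE LANE'S PIECES** — (35)/(61) pp. 265/271 for `Inputs.pieces 𝔎 X 𝔖 k` with the record's `C₄`, from p6's `decomp35_61_std`
with «(63) as cited» = the lane's GAP binder G3D-07 `Binders.LogZLocalizedAsCited` for the DEFINED `logZU`/`logZ1` of the pieces, the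
domains inside `Ω_{k+1}(h)`, the chart configurations `Bcfg` and a linear action `π` (p6 `LogZLocalization.ofCited` + the detecting
property `hdet`): further (α) inputs (28) `bound28`/`small28`, the identification `hPYZ` with the binder's pieces; constants `hC₄`,
`κ ≥ κ₀(32,6)+1`, `0 ≤ C63`, `C63·K₀ ≤ CM`, `κc.r₀ = r₀`, `κ₀ < ½`; the slots `k ≤ K`, `r₀ ≥ 1`, `0 < κ₀`, `R₁ ≥ 6 + 2κ₀`, `0 < p₀`,
`0 ≤ b₀`, `Nblk³ ≤ |T₁^{(k)}|` DISCHARGED. [cite: Balaban1985UV3, (61) p.271 + (63) p.272 + (35) p.265] -/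
theorem decomp35_61_pieces [FiniteDimensional ℂ V] (hk : k + 1 ≤ S.K) (κc : ChartConsts) (hr : κc.r₀ = 𝔎.F.r₀) {κ C63 : ℝ}
    (hκ : kappa₀ (4 * 2 ^ 3) (2 * 3) + 1 ≤ κ) (hC63 : 0 ≤ C63) (hCM : C63 * K₀ (4 * 2 ^ 3) (2 * 3) ≤ κc.CM)
    (hr₀ : 1 ≤ 𝔎.F.r₀) (hκ₀ : 𝔎.F.κ₀ < 1 / 2) (hR₁ : 6 + 2 * 𝔎.F.κ₀ ≤ 𝔎.F.R₁)
    (hC₄ : 𝔎.sc.C₄ = rawConst7 κc.Craw 𝔎.F.b₀ 𝔎.F.r₀ 𝔎.F.p₀ 1 𝔎.F.κ₀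
      + rawConstR (2 * C63 * K₀ (4 * 2 ^ 3) (2 * 3)) 𝔎.F.R₁ 1 𝔎.F.κ₀)
    (bound28 : ∀ Y h U, ‖(𝔖 k).Bcfg Y h U‖ ≤ κc.cB * (rFun κc.r₀ (S.gk k) * S.gk k * pFun 𝔎.F.b₀ 𝔎.F.p₀ (S.gk k)))
    (small28 : κc.cB * (rFun κc.r₀ (S.gk k) * S.gk k * pFun 𝔎.F.b₀ 𝔎.F.p₀ (S.gk k)) ≤ κc.ρ / 4)
    {Γ : Type} (π : Γ → (𝔖 k).E →L[ℂ] (𝔖 k).E)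
    (hdet : ∀ φ : (𝔖 k).E →L[ℂ] ℂ, (∀ u, φ.comp (π u) = φ) → φ = 0)
    (Λc : LogZLocalizedAsCited (towerOf 𝔎 X 𝔖) k (𝔖 k).E π κc.ρ κc.r₀ κc.Cfar C63 κ (pieces 𝔎 X 𝔖 k).logZU
      (pieces 𝔎 X 𝔖 k).logZ1 (𝔖 k).Bcfg
      (fun h => Finset.univ.filter fun Y : (tsys 3 (nblkOf S 𝔎.carrier k)).Dom =>
        Y.1 ⊆ ΩblkOf 𝔎.carrier.M₁ (rcolOf S 𝔎.carrier) (nblkOf S 𝔎.carrier k) h))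
    (hPYZ : ∀ h U, (𝔖 k).PYZ h U
      = ∑ Y ∈ (𝔖 k).loc (ΩblkOf 𝔎.carrier.M₁ (rcolOf S 𝔎.carrier) (nblkOf S 𝔎.carrier k)) (rretOf S 𝔎.carrier k) h,
          ((jet26 (Λc.Ψ Y) ((𝔖 k).Bcfg Y h U)).re - Λc.far Y h U)) :
    Decomp35_61 (pieces 𝔎 X 𝔖 k) 𝔎.sc.C₄ := by
  rw [hC₄]
  exact decomp35_61_std X 𝔎.carrier 𝔖 k (by omega) κc hr hκ hC63 hCM hr₀ 𝔎.F.κ₀_pos hκ₀ hR₁ 𝔎.F.p₀_pos 𝔎.F.b₀_nonneg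
    (nblk_cube_le_sites 𝔎 k (by omega)) bound28 small28 (LogZLocalization.ofCited Λc hdet) hPYZ

/-! ## C8 — `norm35`, B20 — `logZT_le`: the GAP binders G3D-04 / G3D-05 BY NAME -/

/-- **Row C8 AT THE LANE'S PIECES** — (35) p. 265 (and its unprinted k ≥ 1 analogue) for `Inputs.pieces 𝔎 X 𝔖 k` with the record's
`C₅`: the GAP binder G3D-04 `Binders.Norm35StepAsCited` at the pieces, `0 < c`, and `hC₅ : C₅ = cv·(log 2π + max(|log c|,|log a|))/2
+ cJ` (p6 `norm35_series`). [cite: Balaban1985UV3, (35) p.265] -/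
theorem norm35_pieces {c a cv cJ : ℝ} (hc : 0 < c)
    (hC₅ : 𝔎.sc.C₅ = cv * ((Real.log (2 * Real.pi) + max |Real.log c| |Real.log a|) / 2) + cJ)
    (h35 : Norm35StepAsCited (pieces 𝔎 X 𝔖 k) c a cv cJ) : Norm35 (pieces 𝔎 X 𝔖 k) 𝔎.sc.C₅ := by
  rw [hC₅]
  exact norm35_series (X.toTowerBase 𝔎.carrier) 𝔖 (piecesParamsOf S 𝔎.carrier) k hc h35

/-- **Row B20 AT THE LANE'S PIECES** — `|log Z^{(k)}(T₁^{(k)}, 1)| ≤ z|T₁^{(k)}|` (p. 273, (65) input) for `Inputs.pieces 𝔎 X 𝔖 k` with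
the record's `z`: the GAP binder G3D-05 `Binders.LogZTExtensiveAsCited` at the pieces, `0 < c`, and `hz : z = cn·(log 2π +
max(|log c|,|log a|))/2 + cJ` (p6 `logZT_le_series`) — literally the `RunResiduals.logZT_le` field at step `k`. [cite: Balaban1985UV3, (65) p.273] -/
theorem logZT_le_pieces {c a cn cJ : ℝ} (hc : 0 < c)
    (hz : 𝔎.F.z = cn * ((Real.log (2 * Real.pi) + max |Real.log c| |Real.log a|) / 2) + cJ)
    (hZT : LogZTExtensiveAsCited (pieces 𝔎 X 𝔖 k) c a cn cJ) :
    |(pieces 𝔎 X 𝔖 k).logZT| ≤ 𝔎.F.z * S.sites k := by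
  rw [hz]
  exact logZT_le_series (X.toTowerBase 𝔎.carrier) 𝔖 (piecesParamsOf S 𝔎.carrier) k hc hZT

end Summit.QuantumFields.Balaban3D.Proofs.AlphaRepr

end
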